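import Summits.QuantumAdvantage.AdviceFreeQNC0.LowDegreeResidueAvoidance
import Summits.QuantumAdvantage.AdviceFreeQNC0.SymmetrisedCoverage
import HarnessLib

/-!
# Cell qa-qnc0 (rung F-Q1, route RingFrame, crux α, line `product`): a GLOBAL residue-avoidance
# bound — symmetrised coverage of the cube versus the mass in one class mod 3

A new rung-type theorem for the planner's PLDAMS ladder (HOME/qa-qnc0-p1/TARGET.md §17.5, §18;
Sketch5.lean) of the GLOBAL kind that TARGET §18.3 asks for ("a proof of rung 1–3 must use a GLOBAL
invariant of `B`"): it is not rooted at single points, has no degree/density coupling, and holds in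
the full range `d ≤ c₁√n` of the crux-β theorem `lowDegAvoidMod3Sparse`, which it generalises from
"dense supports" to "supports whose permuted copies cover the cube".  Notation: `ψ_k = nzFrac g k`,
`cov_m(g) = Σ_k C(n,k)·(1 − (1 − ψ_k)^m)` = expected number of points covered by `m` uniformly
permuted copies of `{g ≠ 0}` (`SymmetrisedCoverage.lean`; written out as a sum in all statements).

* `coverage_residue_avoidance` (**coverage–avoidance inequality**): for every `γ > 0` there are
  `η, c₁ > 0` and `n₀` such that for `n ≥ n₀`, `d ≤ c₁√n`, `g ∈ lowDeg 𝔽₂ n d`, every residue `r`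
  and every `m`: if `cov_m(g) ≥ 2γ·2ⁿ` then `m · #{g ≠ 0, |u| ≡ r (mod 3)} > η·2ⁿ`.
  (`m = 1`: `cov_1(g) = #{g ≠ 0}`, and this is the crux-β theorem itself.)
* `residue_class_of_spread_layers` (**spread supports meet every class**): if the layers `k` with
  `ψ_k ≥ θ` (`0 < θ ≤ 1`) have total size `Σ C(n,k) ≥ 4γ·2ⁿ`, then
  `2·#{g ≠ 0, |u| ≡ r (mod 3)} > ηθ·2ⁿ`.
* `pldams_of_spread` (**PLDAMS for layer-spread supports**, the planner's shape): for `γ, λ > 0`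
  there is `κ = κ(γ, λ) > 0` with `#{g ≠ 0, |u| ≡ r} ≥ κ·#{g ≠ 0}` for every `d ≤ c₁√n` and EVERY
  density `δ = #{g ≠ 0}/2ⁿ`, provided the layers on which the support has relative density `≥ λδ`
  have total size `≥ 4γ·2ⁿ`.

Consequently the open part of rungs 1–3 of the ladder is confined to LAYER-CONCENTRATED supports:
a family violating PLDAMS must, for every fixed `λ, γ > 0`, eventually keep all but a `λ`-fraction of
its support on Hamming layers of total binomial mass `< 4γ` (where its relative density exceeds `λ`
times, indeed unboundedly many times, its global density) — the symmetric-like sets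
`{|u| ≡ s (mod 2^J)}`, `2^J → ∞`, are the model case, and that is where the layer-to-layer
(Hegedűs-type) tools live.  WHAT THIS IS NOT: not rung 1 (`PLDAMSCLog 1`) — concentrated supports
are not covered; nothing on `LDMAPolylog` or α directly; no separation.

Mechanism (the combination is the cell's; the ingredients are printed and in the tree):
(1) symmetrisation `exists_perms_cover` — some `m`-tuple of coordinate permutations covers
`≥ cov_m(g)` points, while the `m` copies together meet the class `r` in `≤ m·#{g ≠ 0, |u| ≡ r}` points
(`card_filter_comp_perm_class`) and keep the degree (`Hegedus.comp_perm_mem_lowDeg`);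
(2) the degree-free OR-reduction `exists_subset_sum_support_ge` — a sub-sum of the copies, still of
degree `≤ d`, is non-zero on at least half of the covered points;
(3) the crux-β theorem `lowDegAvoidMod3Sparse` [Srinivasan2023, Lemma 3.1 ⇒ TARGET §11.3] applied
to that sub-sum.
presearch (qn-lit gen 6, 2026-08-26): corpus hybrid "randomly permuted copies low degree polynomial
support cover hypercube residue class Hamming weight mod 3" and vsearch (the theorem in prose) → only
generic coding/crypto book pages [carlet2020 p.92/p.198]; galaxy pdf
`"randomly permuted copies|random permutations of the variables|symmetrization argument"` → 10 hits,
none on polynomials; nearest printed device = Srinivasan 2023 Lemma 3.10 (a product of permuted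
copies, used for the opposite purpose: amplifying vanishing).  Not in print as far as searched.

## References

* S. Srinivasan, *A robust version of Hegedűs's lemma, with applications*, TheoretiCS 2 (2023),
  Lemma 3.1 and Lemma 3.10 [Srinivasan2023].
* A. A. Razborov, *Lower bounds on the size of bounded depth circuits over a complete basis with
  logical addition*, Math. Notes 41 (1987) [Razborov1987].
-/

noncomputable section

namespace Summit.QuantumAdvantage.AdviceFreeQNC0

open Finset
open Literature.Computability.MetaComplexity Literature.Computability.MetaComplexity.Smolensky
open Literature.Computability.MetaComplexity.Hegedus

variable {n : ℕ}

/-! ### Step 3: the coverage–avoidance inequality and its corollaries (`𝔽₂`) -/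

/-- **Coverage–avoidance inequality** (global residue-avoidance bound): for every `γ > 0` there are
`η, c₁ > 0` and `n₀` such that for all `n ≥ n₀`, every residue `r`, every `d ≤ c₁√n`, every
`g ∈ lowDeg 𝔽₂ n d` and every `m`: if the symmetrised `m`-fold coverage
`Σ_k C(n,k)·(1 − (1 − ψ_k)^m)` is at least `2γ·2ⁿ`, then `m · #{u : g u ≠ 0, |u| ≡ r (mod 3)} > η·2ⁿ`.
(For `m = 1` the coverage is `#{g ≠ 0}` (`cov_one`) and this is the crux-β theorem
`lowDegAvoidMod3Sparse`.)  The combination is the cell's (qa-qnc0, this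
file); inputs: [cite: Srinivasan2023, Lemma 3.1] via `lowDegAvoidMod3Sparse`, Lemma 3.10's
permutation count, and Razborov's sub-sum device. -/
theorem coverage_residue_avoidance (γ : ℝ) (hγ : 0 < γ) :
    ∃ η : ℝ, 0 < η ∧ ∃ c₁ : ℝ, 0 < c₁ ∧ ∃ n₀ : ℕ, ∀ n ≥ n₀, ∀ r d : ℕ,
      (d : ℝ) ≤ c₁ * Real.sqrt n → ∀ g : CubeFn (ZMod 2) n, g ∈ lowDeg (ZMod 2) n d → ∀ m : ℕ,
        2 * γ * (2 : ℝ) ^ n ≤ ∑ k ∈ range (n + 1), (n.choose k : ℝ) * (1 - (1 - nzFrac g k) ^ m) →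
        η * (2 : ℝ) ^ n <
          m * ((univ.filter fun u : Fin n → Bool => g u ≠ 0 ∧ wt u % 3 = r % 3).card : ℝ) := by
  classical
  obtain ⟨η, hη, c₁, hc₁, n₀, hβ⟩ := lowDegAvoidMod3Sparse (γ / 2) (by positivity)
  refine ⟨η, hη, c₁, hc₁, n₀, fun n hn r d hd g hg m hcov => ?_⟩
  -- Step 1: a good tuple of permutations
  obtain ⟨πs, hπs⟩ := exists_perms_cover g m
  -- Step 2: a good sub-sum
  obtain ⟨S, hS⟩ := exists_subset_sum_support_ge (fun i : Fin m => fun x : Fin n → Bool => g (x ∘ ⇑(πs i)))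
  set P : CubeFn (ZMod 2) n := ∑ i ∈ S, fun x : Fin n → Bool => g (x ∘ ⇑(πs i)) with hP
  have hPdeg : P ∈ lowDeg (ZMod 2) n d :=
    Submodule.sum_mem _ fun i _ => comp_perm_mem_lowDeg (πs i) hg
  -- the support of `P` is large
  have hPsupp : γ * (2 : ℝ) ^ n ≤ ((univ.filter fun u : Fin n → Bool => P u ≠ 0).card : ℝ) := by
    have h2 : ((univ.filter fun x : Fin n → Bool => ∃ i, g (x ∘ ⇑(πs i)) ≠ 0).card : ℝ) ≤
        2 * ((univ.filter fun u : Fin n → Bool => P u ≠ 0).card : ℝ) := by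
      exact_mod_cast hS
    linarith
  -- the class part of the support of `P` is covered by the `m` copies
  have hPclass : ((univ.filter fun u : Fin n → Bool => P u ≠ 0 ∧ wt u % 3 = r % 3).card : ℝ) ≤
      m * ((univ.filter fun u : Fin n → Bool => g u ≠ 0 ∧ wt u % 3 = r % 3).card : ℝ) := by
    have hsub : (univ.filter fun u : Fin n → Bool => P u ≠ 0 ∧ wt u % 3 = r % 3) ⊆
        (univ : Finset (Fin m)).biUnion fun i =>
          univ.filter fun x : Fin n → Bool => g (x ∘ ⇑(πs i)) ≠ 0 ∧ wt x % 3 = r % 3 := by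
      intro u hu
      rw [mem_filter] at hu
      rw [mem_biUnion]
      by_contra hall
      push Not at hall
      apply hu.2.1
      rw [hP, Finset.sum_apply]
      refine sum_eq_zero fun i hi => ?_
      by_contra hne
      exact hall i (mem_univ i) (mem_filter.2 ⟨mem_univ u, hne, hu.2.2⟩)
    have hle := (card_le_card hsub).trans card_biUnion_le
    rw [sum_congr rfl fun i _ => card_filter_comp_perm_class g (πs i) r, sum_const, card_univ,
      Fintype.card_fin, smul_eq_mul] at hle
    exact_mod_cast hle
  -- Step 3: the crux-β theorem applied to `P`
  by_contra hlt
  push Not at hlt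
  have hsmall := hβ n hn r d hd P hPdeg (hPclass.trans hlt)
  have h2n : (0 : ℝ) < (2 : ℝ) ^ n := by positivity
  nlinarith

/-- `(1 − θ)^m ≤ 1/2` once `mθ ≥ 1` (`0 < θ ≤ 1`): Bernoulli, `(1+θ)^m ≥ 1 + mθ ≥ 2` and
`(1−θ)^m (1+θ)^m = (1−θ²)^m ≤ 1`. [folklore] -/
theorem one_sub_pow_le_half {θ : ℝ} (hθ : 0 < θ) (hθ1 : θ ≤ 1) {m : ℕ} (hm : 1 ≤ (m : ℝ) * θ) :
    (1 - θ) ^ m ≤ 1 / 2 := by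
  have hB : 1 + (m : ℝ) * θ ≤ (1 + θ) ^ m := one_add_mul_le_pow (by linarith) m
  have h2 : (2 : ℝ) ≤ (1 + θ) ^ m := by linarith
  have hprod : (1 - θ) ^ m * (1 + θ) ^ m ≤ 1 := by
    rw [← mul_pow]
    refine pow_le_one₀ (by nlinarith) (by nlinarith)
  have hnn : 0 ≤ (1 - θ) ^ m := pow_nonneg (by linarith) m
  rw [le_div_iff₀ (by norm_num : (0 : ℝ) < 2)]
  nlinarith

/-- **Spread supports meet every class.** For every `γ > 0` there are `η, c₁ > 0`, `n₀` such that
for `n ≥ n₀`, `d ≤ c₁√n`, `g ∈ lowDeg 𝔽₂ n d`, every residue `r` and every `θ ∈ (0, 1]`: if the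
Hamming layers `k` on which `g ≠ 0` has relative density `ψ_k ≥ θ` have total size
`Σ C(n,k) ≥ 4γ·2ⁿ`, then `2·#{u : g u ≠ 0, |u| ≡ r (mod 3)} > ηθ·2ⁿ`.  (The cell's; from
`coverage_residue_avoidance` with `m = ⌈1/θ⌉` copies.) [cite: Srinivasan2023, Lemma 3.1] -/
theorem residue_class_of_spread_layers (γ : ℝ) (hγ : 0 < γ) :
    ∃ η : ℝ, 0 < η ∧ ∃ c₁ : ℝ, 0 < c₁ ∧ ∃ n₀ : ℕ, ∀ n ≥ n₀, ∀ r d : ℕ,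
      (d : ℝ) ≤ c₁ * Real.sqrt n → ∀ g : CubeFn (ZMod 2) n, g ∈ lowDeg (ZMod 2) n d →
      ∀ θ : ℝ, 0 < θ → θ ≤ 1 →
        4 * γ * (2 : ℝ) ^ n ≤
          ∑ k ∈ (range (n + 1)).filter (fun k => θ ≤ nzFrac g k), (n.choose k : ℝ) →
        η * θ * (2 : ℝ) ^ n <
          2 * ((univ.filter fun u : Fin n → Bool => g u ≠ 0 ∧ wt u % 3 = r % 3).card : ℝ) := by
  classical
  obtain ⟨η, hη, c₁, hc₁, n₀, hmain⟩ := coverage_residue_avoidance γ hγ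
  refine ⟨η, hη, c₁, hc₁, n₀, fun n hn r d hd g hg θ hθ hθ1 hspread => ?_⟩
  -- the number of copies
  set m : ℕ := ⌈1 / θ⌉₊ with hm
  have hm1 : 1 ≤ (m : ℝ) * θ := by
    have : 1 / θ ≤ (m : ℝ) := Nat.le_ceil _
    calc (1 : ℝ) = 1 / θ * θ := by field_simp
      _ ≤ (m : ℝ) * θ := by nlinarith
  have hm2 : (m : ℝ) * θ ≤ 2 := by
    have : (m : ℝ) < 1 / θ + 1 := Nat.ceil_lt_add_one (by positivity)
    have h1 : (m : ℝ) * θ ≤ (1 / θ + 1) * θ := by nlinarith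
    calc (m : ℝ) * θ ≤ (1 / θ + 1) * θ := h1
      _ = 1 + θ := by field_simp
      _ ≤ 2 := by linarith
  -- coverage of `m` copies is at least half the spread layers
  have hcov : 2 * γ * (2 : ℝ) ^ n ≤
      ∑ k ∈ range (n + 1), (n.choose k : ℝ) * (1 - (1 - nzFrac g k) ^ m) := by
    have hhalf : ∀ k ∈ (range (n + 1)).filter (fun k => θ ≤ nzFrac g k),
        (n.choose k : ℝ) * (1 / 2) ≤ (n.choose k : ℝ) * (1 - (1 - nzFrac g k) ^ m) := by
      intro k hk
      have hθk : θ ≤ nzFrac g k := (mem_filter.1 hk).2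
      have h1 := nzFrac_le_one g k
      have hpow : (1 - nzFrac g k) ^ m ≤ (1 - θ) ^ m :=
        pow_le_pow_left₀ (by linarith) (by linarith) m
      have := one_sub_pow_le_half hθ hθ1 hm1
      exact mul_le_mul_of_nonneg_left (by linarith) (Nat.cast_nonneg _)
    calc 2 * γ * (2 : ℝ) ^ n = (4 * γ * (2 : ℝ) ^ n) * (1 / 2) := by ring
      _ ≤ (∑ k ∈ (range (n + 1)).filter (fun k => θ ≤ nzFrac g k), (n.choose k : ℝ)) * (1 / 2) :=
          mul_le_mul_of_nonneg_right hspread (by norm_num)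
      _ = ∑ k ∈ (range (n + 1)).filter (fun k => θ ≤ nzFrac g k), (n.choose k : ℝ) * (1 / 2) := by
          rw [sum_mul]
      _ ≤ ∑ k ∈ (range (n + 1)).filter (fun k => θ ≤ nzFrac g k),
            (n.choose k : ℝ) * (1 - (1 - nzFrac g k) ^ m) := sum_le_sum hhalf
      _ ≤ ∑ k ∈ range (n + 1), (n.choose k : ℝ) * (1 - (1 - nzFrac g k) ^ m) :=
          sum_le_sum_of_subset_of_nonneg (filter_subset _ _) fun k _ _ =>
            mul_nonneg (Nat.cast_nonneg _) (cov_term_nonneg g k m)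
  have h := hmain n hn r d hd g hg m hcov
  -- `η 2ⁿ < m·N ≤ (2/θ)·N`
  have hN : (0 : ℝ) ≤ ((univ.filter fun u : Fin n → Bool => g u ≠ 0 ∧ wt u % 3 = r % 3).card : ℝ) :=
    Nat.cast_nonneg _
  have h2n : (0 : ℝ) < (2 : ℝ) ^ n := by positivity
  nlinarith

/-- **PLDAMS for layer-spread supports** (the planner's shape, TARGET §17.5 / Sketch5 `PLDAMSAt`):
for every `γ, λ > 0` there are `κ, c₁ > 0`, `n₀` such that for `n ≥ n₀`, `d ≤ c₁√n`,
`g ∈ lowDeg 𝔽₂ n d` with support `B` of density `δ = #B/2ⁿ`, and every residue `r`: if `λδ ≤ 1`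
and the layers on which `B` has relative density `≥ λδ` have total size `≥ 4γ·2ⁿ`, then
`#(B ∩ {|u| ≡ r (mod 3)}) ≥ κ·#B` (`κ = ηλ/2`).  The cell's; inputs as in
`coverage_residue_avoidance`. [cite: Srinivasan2023, Lemma 3.1] -/
theorem pldams_of_spread (γ lam : ℝ) (hγ : 0 < γ) (hlam : 0 < lam) :
    ∃ κ : ℝ, 0 < κ ∧ ∃ c₁ : ℝ, 0 < c₁ ∧ ∃ n₀ : ℕ, ∀ n ≥ n₀, ∀ r d : ℕ,
      (d : ℝ) ≤ c₁ * Real.sqrt n → ∀ g : CubeFn (ZMod 2) n, g ∈ lowDeg (ZMod 2) n d →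
        lam * ((univ.filter fun u : Fin n → Bool => g u ≠ 0).card : ℝ) / (2 : ℝ) ^ n ≤ 1 →
        4 * γ * (2 : ℝ) ^ n ≤
          ∑ k ∈ (range (n + 1)).filter (fun k =>
            lam * ((univ.filter fun u : Fin n → Bool => g u ≠ 0).card : ℝ) / (2 : ℝ) ^ n ≤ nzFrac g k),
            (n.choose k : ℝ) →
        κ * ((univ.filter fun u : Fin n → Bool => g u ≠ 0).card : ℝ) ≤
          ((univ.filter fun u : Fin n → Bool => g u ≠ 0 ∧ wt u % 3 = r % 3).card : ℝ) := by
  classical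
  obtain ⟨η, hη, c₁, hc₁, n₀, hspread⟩ := residue_class_of_spread_layers γ hγ
  refine ⟨η * lam / 2, by positivity, c₁, hc₁, n₀, fun n hn r d hd g hg hθ1 hlayers => ?_⟩
  set N : ℝ := ((univ.filter fun u : Fin n → Bool => g u ≠ 0).card : ℝ) with hN
  have hN0 : 0 ≤ N := Nat.cast_nonneg _
  have h2n : (0 : ℝ) < (2 : ℝ) ^ n := by positivity
  rcases hN0.eq_or_lt with hz | hpos
  · -- empty support: nothing to prove
    rw [← hz, mul_zero]
    exact Nat.cast_nonneg _
  · have hθ : 0 < lam * N / (2 : ℝ) ^ n := by positivity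
    have h := hspread n hn r d hd g hg (lam * N / (2 : ℝ) ^ n) hθ hθ1 hlayers
    have heq : η * (lam * N / (2 : ℝ) ^ n) * (2 : ℝ) ^ n = η * lam * N := by
      field_simp
    rw [heq] at h
    linarith

end Summit.QuantumAdvantage.AdviceFreeQNC0
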